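import Literature.AnabelianGeometry.EtaleTheta.FreeProfinitePermBasis
import Mathlib.GroupTheory.SemidirectProduct
import Mathlib.GroupTheory.SpecificGroups.Cyclic
import Mathlib.GroupTheory.GroupAction.Basic
import Mathlib.Data.ZMod.QuotientGroup
import HarnessLib

/-!
# The two towers of the ROUTE-PBF P-chain: the B-tower `Λ = FreeGroup S ⋊ C → C ∗ B̄_M → Λ/M` (for (PBF₀))
# and the P-tower `FreeGroup S → E_N = FreeGroup B_N ⋊ P_N → FreeGroup S / N` (for (PBF-prime)) — DEFINITIONS

This is the ONE definitions file of the P-chain besides `FreeProfinitePermBasis.lean` (v3, abc-iut-w6-d081 GEN 24: the proof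
files `FreeProfinitePermBasisFree.lean` / `FreeProfinitePermBasisPrime.lean` are theorem-only and import the constructions from
here).  §B (the B-tower, PL3-TREEFREE §3.3): for a permutation `σ` of `S`, `C := ⟨σ⟩ ≤ Perm S` (`Cyc σ`, generator `cgen σ`),
its action `cycAct σ` on `FreeGroup S` by basis permutations, `Λ := FreeGroup S ⋊ C` (`Lam σ`); orbit representatives `rep σ s`
and exponents `idx σ s` (`σ^{idx s} (rep s) = s`; well behaved when `C` acts FREELY: `pow_idx_smul`); for a finite-index normal
`M ⊴ Λ`, `B̄_M ≤ Λ/M` (`Bbar σ M`) generated by the classes of the representative letters, `f_M : Λ → C ∗ B̄_M` (`fM`; letter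
`s = σ^i(rep s) ↦ c^i · b̄(rep s) · c^{-i}`, `c ↦ c`) and `g_M : C ∗ B̄_M → Λ/M` (`gM`) with `g_M ∘ f_M = (Λ → Λ/M)`
(`gM_comp_fM`).  §P (the P-tower, PL3-TREEFREE §3.2 (iii), iso-free form): `X′ = {s | σ s ≠ s}` (`Xp σ`), `σ|X′` (`sigmaX`),
`P_N ≤ FreeGroup S / N` the image of `⟨S^σ⟩` (`PN σ N`), the basis `B_N = P_N × X′` (`BN`), `E_N = FreeGroup B_N ⋊ P_N` (`EN`, action
`actN` by left translation of the first coordinate), the free exponent-`q` permutation `σ_B = id × σ|X′` (`sigmaB`) and its extension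
`σ_E` (`sigmaE`), `π_N : FreeGroup S → E_N` (`piN`; fixed letter `y ↦ ȳ ∈ P_N`, moved letter `x ↦ (1, x) ∈ B_N`),
`ρ_N : E_N → FreeGroup S / N` (`rhoN`) with `ρ_N ∘ π_N = (FreeGroup S → FreeGroup S / N)` and `π_N ∘ σ = σ_E ∘ π_N`, the retraction
`r_P` onto the `P_N`-part.  Every declaration carries its defining identity as a theorem.

HONEST FRAMING. Classical profinite group theory (free profinite groups as completions of free groups); DEFINITIONS of the
ROUTE-PBF P-chain's two towers and their defining identities — no `def … : Prop`, no named fact, no instance, no notation; no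
(E)-class module and no `SettingModel*` file is imported; nothing of [EtTh]/[IUTchII]/[IUTchIII] in print is asserted; CELL hextΔ/hΘ
UNDECIDED-AT-MODEL; no side is taken on [IUTchIII] Cor. 3.12; nothing here says abc is proved or refuted.  abc-iut cell, programme
P-L2, rung (L3′), ROUTE-PBF, P-chain (seat abc-iut-w6-d081 GEN 23; v3 GEN 24); desk: PL3-TREEFREE (abc-iut-L6-t19 g22).
-/

noncomputable section

namespace Literature.AnabelianGeometry.EtaleTheta.SettingModel.TreeFree

open CategoryTheory Topology
open Literature.IUT.HodgeTheaters (profiniteCompletion toCompletion)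

universe u

/-! ## §B The B-tower (for (PBF₀)) -/

section BTower

variable {S : Type u}

variable (σ : Equiv.Perm S)

/-- `C = ⟨σ⟩ ≤ Perm S`. [cite: RibesZalesskii2010, §3.2] -/
abbrev Cyc : Subgroup (Equiv.Perm S) := Subgroup.zpowers σ

/-- the generator `c = σ` of `C`. [cite: RibesZalesskii2010, §3.2] -/
def cgen : Cyc σ := ⟨σ, Subgroup.mem_zpowers σ⟩

/-- The generator `cgen σ` of `C = ⟨σ⟩` is `σ`. [cite: RibesZalesskii2010, §3.2] -/
@[simp] theorem coe_cgen : ((cgen σ : Cyc σ) : Equiv.Perm S) = σ := rfl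

/-- the action of `C` on `FreeGroup S` by basis permutations. [cite: RibesZalesskii2010, §3.2] -/
abbrev cycAct : Cyc σ →* MulAut (FreeGroup S) := (permAut (S := S)).comp (Cyc σ).subtype

/-- `Λ = FreeGroup S ⋊ C`. [cite: RibesZalesskii2010, §3.2] -/
abbrev Lam : Type u := FreeGroup S ⋊[cycAct σ] Cyc σ

/-- The action of `g ∈ C` on `FreeGroup S` is `FreeGroup.map g`. [cite: RibesZalesskii2010, §3.2] -/
theorem cycAct_apply (g : Cyc σ) (x : FreeGroup S) : cycAct σ g x = FreeGroup.map (g : Equiv.Perm S) x := rfl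

/-! ### Orbit representatives and exponents (the action of `C` on `S`) -/

/-- The action of `C ≤ Perm S` on `S` is evaluation. [cite: RibesZalesskii2010, §3.2] -/
theorem coe_smul (g : Cyc σ) (s : S) : g • s = (g : Equiv.Perm S) s := rfl

/-- a representative of the `C`-orbit of `s`. [cite: RibesZalesskii2010, §3.2] -/
def rep (s : S) : S := (Quotient.mk (MulAction.orbitRel (Cyc σ) S) s).out

/-- `rep` is constant on `C`-orbits. [cite: RibesZalesskii2010, §3.2] -/
theorem rep_smul (g : Cyc σ) (s : S) : rep σ (g • s) = rep σ s := by
  unfold rep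
  congr 1
  apply Quotient.sound
  exact MulAction.orbitRel_apply.mpr (MulAction.mem_orbit s g)

/-- Some element of `C` carries `rep s` to `s`. [cite: RibesZalesskii2010, §3.2] -/
theorem exists_smul_rep_eq (s : S) : ∃ g : Cyc σ, g • rep σ s = s := by
  have h : MulAction.orbitRel (Cyc σ) S (rep σ s) s := Quotient.exact (Quotient.out_eq _)
  obtain ⟨g, hg⟩ := MulAction.orbitRel_apply.mp h
  exact ⟨g⁻¹, by rw [← hg, inv_smul_smul]⟩

/-- Some integer power of the generator carries `rep s` to `s`. [cite: RibesZalesskii2010, §3.2] -/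
theorem exists_zpow_smul_rep_eq (s : S) : ∃ n : ℤ, (cgen σ ^ n) • rep σ s = s := by
  obtain ⟨g, hg⟩ := exists_smul_rep_eq σ s
  obtain ⟨n, hn⟩ := Subgroup.mem_zpowers_iff.mp g.2
  refine ⟨n, ?_⟩
  have : cgen σ ^ n = g := Subtype.ext (by simp [hn])
  rw [this, hg]

/-- the exponent `idx s ∈ ℤ` with `σ^{idx s} (rep s) = s`. [cite: RibesZalesskii2010, §3.2] -/
def idx (s : S) : ℤ := Classical.choose (exists_zpow_smul_rep_eq σ s)

/-- Defining property of `idx`: `σ^{idx s} (rep s) = s`. [cite: RibesZalesskii2010, §3.2] -/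
theorem idx_spec (s : S) : (cgen σ ^ idx σ s) • rep σ s = s := Classical.choose_spec (exists_zpow_smul_rep_eq σ s)

variable {σ} {q : ℕ} (hq : q.Prime) (hσq : σ ^ q = 1) (hfree : ∀ s, σ s ≠ s)
include hq hσq

/-- `|C| = q` when `σ ≠ 1` has `σ^q = 1`, `q` prime. [cite: RibesZalesskii2010, §3.2] -/
theorem card_Cyc {s : S} (hs : σ s ≠ s) : Nat.card (Cyc σ) = q := by
  haveI : Fact q.Prime := ⟨hq⟩
  rw [Nat.card_zpowers]
  apply orderOf_eq_prime hσq
  intro h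
  exact hs (by rw [h]; rfl)

include hfree

/-- `C` acts FREELY on `S`: an element of `C` with a fixed point is trivial (`|C| = q` is prime and the
stabiliser is not everything since `σ` moves every letter). [cite: RibesZalesskii2010, §3.2] -/
theorem eq_one_of_smul_eq (g : Cyc σ) (r : S) (hgr : g • r = r) : g = 1 := by
  haveI : Fact (Nat.card (Cyc σ)).Prime := ⟨by rw [card_Cyc hq hσq (hfree r)]; exact hq⟩
  rcases (MulAction.stabilizer (Cyc σ) r).eq_bot_or_eq_top_of_prime_card with h | h
  · have hg : g ∈ MulAction.stabilizer (Cyc σ) r := hgr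
    rw [h] at hg
    exact hg
  · exfalso
    have hc : cgen σ ∈ MulAction.stabilizer (Cyc σ) r := by rw [h]; exact Subgroup.mem_top _
    exact hfree r hc

/-- the exponents transform correctly under the action: `c^{idx (g s)} = g · c^{idx s}`. [cite: RibesZalesskii2010, §3.2] -/
theorem pow_idx_smul (g : Cyc σ) (s : S) : cgen σ ^ idx σ (g • s) = g * cgen σ ^ idx σ s := by
  have h1 : (cgen σ ^ idx σ (g • s)) • rep σ s = g • s := by
    have := idx_spec σ (g • s)
    rwa [rep_smul] at this
  have h2 : (g * cgen σ ^ idx σ s) • rep σ s = g • s := by rw [mul_smul, idx_spec]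
  have h3 : ((g * cgen σ ^ idx σ s)⁻¹ * cgen σ ^ idx σ (g • s)) • rep σ s = rep σ s := by
    rw [mul_smul, h1, ← h2, inv_smul_smul]
  have := eq_one_of_smul_eq hq hσq hfree _ _ h3
  rw [inv_mul_eq_one] at this
  exact this.symm

omit hq hσq hfree

/-! ### The tower level `M`: `B̄_M`, `f_M : Λ → C ∗ B̄_M`, `g_M : C ∗ B̄_M → Λ/M` -/

variable (σ) (M : FiniteIndexNormalSubgroup (Lam σ))

/-- `B̄_M ≤ Λ/M`: the subgroup generated by the classes of the representative letters. [cite: RibesZalesskii2010, §3.2] -/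
abbrev Bbar : Subgroup (Lam σ ⧸ M.toSubgroup) :=
  Subgroup.closure (Set.range fun s : S =>
    (QuotientGroup.mk (SemidirectProduct.inl (FreeGroup.of (rep σ s))) : Lam σ ⧸ M.toSubgroup))

/-- the class of the representative letter of `s`, as an element of `B̄_M`. [cite: RibesZalesskii2010, §3.2] -/
def bbar (s : S) : Bbar σ M :=
  ⟨QuotientGroup.mk (SemidirectProduct.inl (FreeGroup.of (rep σ s))), Subgroup.subset_closure ⟨s, rfl⟩⟩

/-- `bbar` is constant on `C`-orbits. [cite: RibesZalesskii2010, §3.2] -/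
theorem bbar_smul (g : Cyc σ) (s : S) : bbar σ M (g • s) = bbar σ M s :=
  Subtype.ext (by simp [bbar, rep_smul])

/-- `f_M` on letters: `s ↦ c^{idx s} · b̄(rep s) · c^{-idx s}`. [cite: RibesZalesskii2010, §3.2] -/
def fLetters : FreeGroup S →* Monoid.Coprod (Cyc σ) (Bbar σ M) :=
  FreeGroup.lift fun s =>
    Monoid.Coprod.inl (cgen σ ^ idx σ s) * Monoid.Coprod.inr (bbar σ M s) * (Monoid.Coprod.inl (cgen σ ^ idx σ s))⁻¹

variable {σ M}
include hq hσq hfree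

/-- compatibility of `fLetters` with the action (so that it extends to the semidirect product). [cite: RibesZalesskii2010, §3.2] -/
theorem fLetters_compat (g : Cyc σ) :
    (fLetters σ M).comp (cycAct σ g).toMonoidHom =
      (MulAut.conj (Monoid.Coprod.inl g : Monoid.Coprod (Cyc σ) (Bbar σ M))).toMonoidHom.comp (fLetters σ M) := by
  ext s
  show fLetters σ M (cycAct σ g (FreeGroup.of s)) =
    Monoid.Coprod.inl g * fLetters σ M (FreeGroup.of s) * (Monoid.Coprod.inl g)⁻¹
  have hgs : cycAct σ g (FreeGroup.of s) = FreeGroup.of (g • s) := by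
    rw [cycAct_apply, FreeGroup.map.of]; rfl
  rw [hgs]
  simp only [fLetters, FreeGroup.lift_apply_of]
  rw [pow_idx_smul hq hσq hfree g s, bbar_smul, map_mul, mul_inv_rev]
  simp only [mul_assoc]

/-- `f_M : Λ → C ∗ B̄_M`. [cite: RibesZalesskii2010, §3.2] -/
def fM : Lam σ →* Monoid.Coprod (Cyc σ) (Bbar σ M) :=
  SemidirectProduct.lift (fLetters σ M) Monoid.Coprod.inl (fLetters_compat hq hσq hfree)

/-- `f_M` on the `C`-part: `f_M (inr g) = inl g`. [cite: RibesZalesskii2010, §3.2] -/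
@[simp] theorem fM_inr (g : Cyc σ) : fM hq hσq hfree (M := M) (SemidirectProduct.inr g) = Monoid.Coprod.inl g := by
  simp [fM]

/-- `f_M` on the free part is `fLetters`. [cite: RibesZalesskii2010, §3.2] -/
@[simp] theorem fM_inl (x : FreeGroup S) : fM hq hσq hfree (M := M) (SemidirectProduct.inl x) = fLetters σ M x := by
  simp [fM]

omit hq hσq hfree in
/-- `g_M : C ∗ B̄_M → Λ/M`. [cite: RibesZalesskii2010, §3.2] -/
def gM : Monoid.Coprod (Cyc σ) (Bbar σ M) →* Lam σ ⧸ M.toSubgroup :=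
  Monoid.Coprod.lift ((QuotientGroup.mk' M.toSubgroup).comp SemidirectProduct.inr) (Bbar σ M).subtype

/-- `g_M ∘ f_M = (Λ → Λ/M)`. [cite: RibesZalesskii2010, §3.2] -/
theorem gM_comp_fM : (gM (M := M)).comp (fM hq hσq hfree) = QuotientGroup.mk' M.toSubgroup := by
  apply SemidirectProduct.hom_ext
  · ext s
    simp only [MonoidHom.coe_comp, Function.comp_apply, fM_inl, fLetters, FreeGroup.lift_apply_of, gM,
      map_mul, map_inv, Monoid.Coprod.lift_apply_inl, Monoid.Coprod.lift_apply_inr, Subgroup.coe_subtype,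
      QuotientGroup.mk'_apply, bbar]
    rw [← QuotientGroup.mk_inv, ← QuotientGroup.mk_mul, ← QuotientGroup.mk_mul, ← map_inv,
      ← SemidirectProduct.inl_aut, cycAct_apply, FreeGroup.map.of]
    exact congrArg _ (congrArg _ (congrArg FreeGroup.of (idx_spec σ s)))
  · ext g
    simp [gM]

end BTower

/-! ## §P The P-tower (for (PBF) at prime exponent) -/

section PTower

variable {S : Type u}

/-! ### The P-tower objects at level `N` -/

variable (σ : Equiv.Perm S)

/-- the moved letters `X′`. [cite: RibesZalesskii2010, §3.2] -/
abbrev Xp : Type u := {s : S // σ s ≠ s}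

/-- `σ` restricted to the moved letters. [cite: RibesZalesskii2010, §3.2] -/
def sigmaX : Equiv.Perm (Xp σ) :=
  σ.subtypePerm (p := fun s => σ s ≠ s) (fun _ => not_congr σ.apply_eq_iff_eq)

/-- `σ|X′` is `σ` on the underlying letters. [cite: RibesZalesskii2010, §3.2] -/
@[simp] theorem coe_sigmaX_apply (x : Xp σ) : ((sigmaX σ x : Xp σ) : S) = σ x := rfl

variable (N : FiniteIndexNormalSubgroup (FreeGroup S))

/-- `P_N ≤ FreeGroup S / N`: the image of `⟨Y⟩`, `Y = S^σ`. [cite: RibesZalesskii2010, §3.2] -/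
abbrev PN : Subgroup (FreeGroup S ⧸ N.toSubgroup) :=
  (Subgroup.closure (FreeGroup.of '' {s : S | σ s = s})).map (QuotientGroup.mk' N.toSubgroup)

/-- the basis `B_N = P_N × X′`. [cite: RibesZalesskii2010, §3.2] -/
abbrev BN : Type u := PN σ N × Xp σ

/-- `P_N` acting on `B_N` by left translation of the first factor, as permutations. [cite: RibesZalesskii2010, §3.2] -/
def actPerm : PN σ N →* Equiv.Perm (BN σ N) where
  toFun p := Equiv.prodCongr (Equiv.mulLeft p) (Equiv.refl _)
  map_one' := by ext ⟨p', x⟩ <;> simp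
  map_mul' p₁ p₂ := by ext ⟨p', x⟩ <;> simp [mul_assoc]

/-- `actPerm p (p′, x) = (p p′, x)`. [cite: RibesZalesskii2010, §3.2] -/
@[simp] theorem actPerm_apply (p : PN σ N) (b : BN σ N) : actPerm σ N p b = (p * b.1, b.2) := rfl

/-- the action on the free group. [cite: RibesZalesskii2010, §3.2] -/
abbrev actN : PN σ N →* MulAut (FreeGroup (BN σ N)) := (permAut (S := BN σ N)).comp (actPerm σ N)

/-- The action of `P_N` on `FreeGroup B_N` is `FreeGroup.map (actPerm p)`. [cite: RibesZalesskii2010, §3.2] -/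
theorem actN_apply (p : PN σ N) (x : FreeGroup (BN σ N)) : actN σ N p x = FreeGroup.map (actPerm σ N p) x := rfl

/-- `E_N = FreeGroup B_N ⋊ P_N`. [cite: RibesZalesskii2010, §3.2] -/
abbrev EN : Type u := FreeGroup (BN σ N) ⋊[actN σ N] PN σ N

/-- the permutation `σ_B = id × σ|X′` of the basis `B_N` (FREE, of exponent `q`). [cite: RibesZalesskii2010, §3.2] -/
def sigmaB : Equiv.Perm (BN σ N) := Equiv.prodCongr (Equiv.refl _) (sigmaX σ)

/-- `σ_B (p, x) = (p, σ x)`. [cite: RibesZalesskii2010, §3.2] -/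
@[simp] theorem sigmaB_apply (b : BN σ N) : sigmaB σ N b = (b.1, sigmaX σ b.2) := rfl

/-- `σ_B` commutes with the `P_N`-action on `B_N`. [cite: RibesZalesskii2010, §3.2] -/
theorem sigmaB_actPerm_comm (p : PN σ N) (b : BN σ N) :
    sigmaB σ N (actPerm σ N p b) = actPerm σ N p (sigmaB σ N b) := rfl

/-- `σ` acting on `E_N`: `permAut σ_B` on the free factor, identity on `P_N`. [cite: RibesZalesskii2010, §3.2] -/
def sigmaE : EN σ N →* EN σ N :=
  SemidirectProduct.map (permAut (sigmaB σ N)).toMonoidHom (MonoidHom.id _) (fun p => by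
    ext b
    simp only [MonoidHom.coe_comp, MulEquiv.coe_toMonoidHom, Function.comp_apply, permAut_apply,
      FreeGroup.map.of, MonoidHom.id_apply]
    rw [sigmaB_actPerm_comm])

/-- `σ_E` on the free part is `FreeGroup.map σ_B`. [cite: RibesZalesskii2010, §3.2] -/
theorem sigmaE_inl (x : FreeGroup (BN σ N)) :
    sigmaE σ N (SemidirectProduct.inl x) = SemidirectProduct.inl (FreeGroup.map (sigmaB σ N) x) := by
  simp [sigmaE, SemidirectProduct.map_inl]

/-- `σ_E` is the identity on `P_N`. [cite: RibesZalesskii2010, §3.2] -/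
theorem sigmaE_inr (p : PN σ N) : sigmaE σ N (SemidirectProduct.inr p) = SemidirectProduct.inr p := by
  simp [sigmaE, SemidirectProduct.map_inr]

/-- the class of a fixed letter, as an element of `P_N`. [cite: RibesZalesskii2010, §3.2] -/
def ybar (s : S) (hs : σ s = s) : PN σ N :=
  ⟨QuotientGroup.mk (FreeGroup.of s), Subgroup.mem_map.mpr ⟨FreeGroup.of s, Subgroup.subset_closure ⟨s, hs, rfl⟩, rfl⟩⟩

/-- `π_N : FreeGroup S → E_N`. [cite: RibesZalesskii2010, §3.2] -/
def piN [DecidableEq S] : FreeGroup S →* EN σ N :=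
  FreeGroup.lift fun s => if hs : σ s = s then SemidirectProduct.inr (ybar σ N s hs)
    else SemidirectProduct.inl (FreeGroup.of ((1 : PN σ N), (⟨s, hs⟩ : Xp σ)))

/-- `ρ_N : E_N → FreeGroup S / N`. [cite: RibesZalesskii2010, §3.2] -/
def rhoN : EN σ N →* FreeGroup S ⧸ N.toSubgroup :=
  SemidirectProduct.lift
    (FreeGroup.lift fun b : BN σ N => (b.1 : FreeGroup S ⧸ N.toSubgroup) * QuotientGroup.mk (FreeGroup.of (b.2 : S)) *
      (b.1 : FreeGroup S ⧸ N.toSubgroup)⁻¹)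
    (PN σ N).subtype
    (fun p => by
      ext b
      simp only [MonoidHom.coe_comp, MulEquiv.coe_toMonoidHom, Function.comp_apply, permAut_apply,
        FreeGroup.map.of, FreeGroup.lift_apply_of, actPerm_apply, MulAut.conj_apply, Subgroup.coe_subtype,
        Subgroup.coe_mul, mul_inv_rev]
      simp only [mul_assoc])

/-- `ρ_N ∘ π_N` is the quotient map `FreeGroup S → FreeGroup S / N`. [cite: RibesZalesskii2010, §3.2] -/
theorem rhoN_comp_piN [DecidableEq S] : (rhoN σ N).comp (piN σ N) = QuotientGroup.mk' N.toSubgroup := by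
  ext s
  by_cases hs : σ s = s
  · simp [piN, rhoN, hs, ybar]
  · simp [piN, rhoN, hs]

/-- `π_N` intertwines `FreeGroup.map σ` with `σ_E`. [cite: RibesZalesskii2010, §3.2] -/
theorem piN_comp_map [DecidableEq S] : (piN σ N).comp (FreeGroup.map σ) = (sigmaE σ N).comp (piN σ N) := by
  apply FreeGroup.ext_hom
  intro s
  by_cases hs : σ s = s
  · simp only [MonoidHom.coe_comp, Function.comp_apply, FreeGroup.map.of, piN, FreeGroup.lift_apply_of, hs,
      dite_true, sigmaE_inr]
  · have hσs : ¬ σ (σ s) = σ s := fun h => hs (σ.injective h)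
    simp only [MonoidHom.coe_comp, Function.comp_apply, FreeGroup.map.of, piN, FreeGroup.lift_apply_of, hs,
      dite_false, sigmaE_inl, sigmaB_apply]
    rw [dif_neg hσs]
    rfl

/-- the retraction `r_P = inr ∘ rightHom : E_N → E_N` onto the `P_N`-part. [cite: RibesZalesskii2010, §3.2] -/
abbrev rP : EN σ N →* EN σ N := (SemidirectProduct.inr).comp SemidirectProduct.rightHom

/-- `rightHom ∘ r_P = rightHom`. [cite: RibesZalesskii2010, §3.2] -/
theorem rightHom_comp_rP : (SemidirectProduct.rightHom).comp (rP σ N) = SemidirectProduct.rightHom := by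
  ext e; simp

/-- `σ_E` commutes with the retraction `r_P`. [cite: RibesZalesskii2010, §3.2] -/
theorem sigmaE_comp_rP : (sigmaE σ N).comp (rP σ N) = (rP σ N).comp (sigmaE σ N) := by
  apply SemidirectProduct.hom_ext
  · exact MonoidHom.ext fun x => by simp [sigmaE_inl]
  · exact MonoidHom.ext fun p => by simp [sigmaE_inr]

/-- `rightHom ∘ σ_E = rightHom`. [cite: RibesZalesskii2010, §3.2] -/
theorem rightHom_comp_sigmaE : (SemidirectProduct.rightHom).comp (sigmaE σ N) =
    (SemidirectProduct.rightHom : EN σ N →* PN σ N) := by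
  rw [sigmaE, SemidirectProduct.rightHom_comp_map]; rfl

/-- `ρ_N ∘ r_P = (P_N ⊆ FreeGroup S / N) ∘ rightHom`. [cite: RibesZalesskii2010, §3.2] -/
theorem rhoN_comp_rP : (rhoN σ N).comp (rP σ N) = (PN σ N).subtype.comp SemidirectProduct.rightHom := by
  ext e; simp [rhoN]

variable {σ N}

/-- powers of `σ_B`. [cite: RibesZalesskii2010, §3.2] -/
theorem sigmaB_pow_apply (m : ℕ) (b : BN σ N) : (sigmaB σ N ^ m) b = (b.1, (sigmaX σ ^ m) b.2) := by
  induction m with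
  | zero => simp
  | succ m ih => rw [pow_succ', pow_succ', Equiv.Perm.mul_apply, Equiv.Perm.mul_apply, ih, sigmaB_apply]

/-- `σ|X′` has exponent `q` when `σ` does. [cite: RibesZalesskii2010, §3.2] -/
theorem sigmaX_pow_eq_one {q : ℕ} (hσq : σ ^ q = 1) : sigmaX σ ^ q = 1 := by
  rw [sigmaX, Equiv.Perm.subtypePerm_pow]
  ext x
  simp [hσq]

/-- `σ_B` has exponent `q` when `σ` does. [cite: RibesZalesskii2010, §3.2] -/
theorem sigmaB_pow_eq_one {q : ℕ} (hσq : σ ^ q = 1) : sigmaB σ N ^ q = 1 := by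
  ext b
  · rw [sigmaB_pow_apply]; rfl
  · rw [sigmaB_pow_apply, sigmaX_pow_eq_one hσq]; rfl

/-- `σ_B` is fixed-point-free. [cite: RibesZalesskii2010, §3.2] -/
theorem sigmaB_ne (b : BN σ N) : sigmaB σ N b ≠ b := by
  intro h
  have h2 := congrArg (fun c : BN σ N => ((c.2 : Xp σ) : S)) h
  simp only [sigmaB_apply, coe_sigmaX_apply] at h2
  exact b.2.2 h2

/-- `range inl ≤ E_N` has finite index (`= ker rightHom`, `P_N` finite). [cite: RibesZalesskii2010, §3.2] -/
theorem finiteIndex_range_inl [Finite (PN σ N)] :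
    (SemidirectProduct.inl : FreeGroup (BN σ N) →* EN σ N).range.FiniteIndex := by
  rw [SemidirectProduct.range_inl_eq_ker_rightHom]
  refine ⟨?_⟩
  rw [Subgroup.index_ker]
  exact Nat.card_pos.ne'

end PTower

end Literature.AnabelianGeometry.EtaleTheta.SettingModel.TreeFree

end
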